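import Summits.BirchSwinnertonDyer.Rank1Residual.X11b.FittingCongruenceLimit
import Summits.BirchSwinnertonDyer.Rank1Residual.X11b.FittingVersusCharIdeal
import Summits.BirchSwinnertonDyer.Rank1Residual.X11b.UnrIntegersValuationRing
import HarnessLib

/-!
# O9 (row B11), road H — the ONE-SIDED REVERSE congruence limit behind Keller–Yin's Thm. D″, as
# pure algebra over the receptacle `Λ^nr = R₀⟦T⟧` (cell `bsd-eis`, seat `bsd-eis-cgshw` g8; route
# `EisensteinPrimes`, crux 4 `BSDpOnCellC`, line b1; memos cgshw MEMO-8 §11 / MEMO-9; THEOREMS ONLY)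

HONEST FRAMING (cell `bsd-eis`, run/shared/lean/pub/bsd-eis/): theorems only — no definition, no
named fact, no `sorry`; nothing about any curve is asserted; X2 stays CONSTRUCTION-SHAPED; no label
or count moves. This file is the algebra the typed companion of road H (MEMO-8 §11, referee g23:
«the Lean companion may proceed as planned») needs and which the tree did not yet have over
`R₀⟦T⟧` (cgshw g7 FINAL: «needs IsNoetherianRing / IsLocalRing for `UnrSeries p`»):

* §1 `isDiscreteValuationRing_unrIntegers` — the tree's `R₀ = unrIntegers p ⊂ ℂ_p` (Castella 2018
  §3: `𝒪(\widehat{ℚ_p^ur})`) IS a discrete valuation ring with uniformiser `p` (a THEOREM, not an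
  instance: every nonzero `x ∈ R₀` is `p^n · u` with `‖u‖ = 1`, by the tree's
  `R1.exists_norm_eq_inv_pow` and `unrIntegers.isUnit_iff_norm_eq_one`); hence
  `isNoetherianRing_unrSeries` (`R₀⟦T⟧` Noetherian), `isLocalRing_unrSeries`, and
  `span_C_p_le_jacobson_unrSeries` (`(p) ⊆ Jac(R₀⟦T⟧)`).
* §2 `map_le_span_of_oneSided_congruences` — the REVERSE one-sided limit across a ring map
  `φ : R → S` (`Λ → Λ^nr`), `S` Noetherian, `φ(I) ⊆ Jac(S)`: from `J ⊆ Fitt_R(M)` (`J = (p)^a·(g)`,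
  the finite-submodule bound of the FIXED module `M = 𝔛_f`), the congruence isomorphisms
  `e_m : M/I^m ≅ N_m/I^m` over `R` [(α) + control], the member-side ONE-SIDED inclusions
  `φ(Fitt_R(N_m)) ⊆ (L_m)` in `S` [(d): the member's main conjecture, read as `Fitt₀ ⊆ Ch = (𝓛_{f_m})`]
  and the `L`-function congruences `(L_m) + φ(I)^m = (L) + φ(I)^m` in `S` [(b)], conclude
  `φ(J) ⊆ (L)`. No tensor products: «Fitting ideals modulo `I^m`» is taken over `R`
  (`fittingIdeal_sup_eq_of_quotEquiv`), mapped to `S`, and closed by Krull (`iInf_sup_pow_eq_self`).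
  This is `X2.KellerYinFreePartGap.charIdeal_eq_span_of_oneSided_congruences` (ky K4, one ring)
  with its TWO rings separated and its conclusion cut down to the half road H actually delivers
  before D′ is invoked (`L ∣ p^a·g`; the closing by `μ = 0` + `λ` is the separate glue of
  `X2/HidaLimitRoad.lean`, p419866).
* §3 `C_pow_mul_map_mem_span_of_oneSided_congruences` — §2 at `R = Λ = ℤ_p⟦T⟧`, `S = R₀⟦T⟧`,
  `φ = map toUnr`, `I = (p)`, `J = (p)^a·(F)`: the conclusion is literally the body of
  `X2.HidaLimitRevDivOnTree` (p419866) — `C(p^a)·F^nr ∈ (L)` — so road H's typed inputs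
  (member data) imply its typed output by THIS theorem (the packaging as one predicate
  `HidaLimitInputsAt` and the glue ride in the companion definition file).

References: Keller–Yin arXiv:2402.12781v2 §5.1 (a)–(e), Thm. 5.1.3 [KellerYin2024, PRE — shape only,
nothing asserted]; C. Skinner, Pacific J. Math. 283 (2016) §3.1 [Skinner2016PacificMC]; F. Castella,
erratum to CJM 6 (2018), proof of Thm. 1.1 (p. 4) [Castella2018Erratum]; F. Castella, CJM 6 (2018)
§3 p. 9 (`R₀`) [Castella2018]; Stacks 07ZA, 05GI [StacksProject]; cell memos bsd-eis-ky MEMO-2 §4,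
cgshw MEMO-8 §11, MEMO-9.
-/

set_option autoImplicit false

noncomputable section

open scoped Classical

open PowerSeries Literature.NumberTheory.EllipticCurves Literature.NumberTheory.EllipticCurves.Module
  Literature.RingTheory.FittingIdeal
  Summit.BirchSwinnertonDyer.Rank1Residual.X11b
  Summit.BirchSwinnertonDyer.Rank1Residual.X11b.Halves
  Summit.BirchSwinnertonDyer.Rank1Residual.X11b.CongruenceLimit

open Literature.NumberTheory.LFunctions.Dwork (norm_natCast_p_padicComplex)

namespace Summit.BirchSwinnertonDyer.Rank1Residual.X2.HidaLimitAlgebra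

universe u v

/-! ## §1 `R₀` is a discrete valuation ring with uniformiser `p`; `R₀⟦T⟧` is Noetherian and local -/

section UnrIntegers

variable {p : ℕ} [hp : Fact p.Prime]

/-- `‖x‖ = 1` for `x ∈ R₀` iff `x` is a unit of `R₀` — restated on elements of the subtype.
[cite: SerreLocalFields1979, Ch. II §5, Thm. 3] -/
theorem isUnit_of_norm_eq_one {x : unrIntegers p} (hx : ‖(x : ℂ_[p])‖ = 1) : IsUnit x :=
  (unrIntegers.isUnit_iff_norm_eq_one x).mpr hx

/-- In `R₀`, a non-unit has norm `≤ p⁻¹`. [folklore] -/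
theorem norm_le_inv_of_not_isUnit {x : unrIntegers p} (hx : ¬ IsUnit x) :
    ‖(x : ℂ_[p])‖ ≤ (p : ℝ)⁻¹ := by
  have h1 : ‖(x : ℂ_[p])‖ ≤ 1 := norm_le_one_of_mem_unrIntegers p x.2
  have hne : ‖(x : ℂ_[p])‖ ≠ 1 := fun h ↦ hx (isUnit_of_norm_eq_one h)
  exact R1.norm_le_inv_of_norm_lt_one x.2 (lt_of_le_of_ne h1 hne)

/-- **`p` is irreducible in `R₀`**: it is not a unit (`‖p‖ = p⁻¹`), and in a factorisation
`p = a·b` one factor has norm `1` (norms of non-units are `≤ p⁻¹`, and `p⁻² < p⁻¹`).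
[cite: Castella2018, §3 (p. 9)] -/
theorem irreducible_natCast_p : Irreducible ((p : ℕ) : unrIntegers p) := by
  have hp' : p.Prime := hp.out
  have hpR : (1 : ℝ) < p := by exact_mod_cast hp'.one_lt
  have hnp : ‖(((p : ℕ) : unrIntegers p) : ℂ_[p])‖ = (p : ℝ)⁻¹ := by
    rw [SubringClass.coe_natCast]; exact norm_natCast_p_padicComplex
  refine ⟨fun hu ↦ ?_, fun a b hab ↦ ?_⟩
  · have h1 := (unrIntegers.isUnit_iff_norm_eq_one _).mp hu
    rw [hnp] at h1
    exact (inv_lt_one_of_one_lt₀ hpR).ne h1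
  · by_contra h
    rw [not_or] at h
    have ha := norm_le_inv_of_not_isUnit h.1
    have hb := norm_le_inv_of_not_isUnit h.2
    have hprod : ‖(((p : ℕ) : unrIntegers p) : ℂ_[p])‖ = ‖(a : ℂ_[p])‖ * ‖(b : ℂ_[p])‖ := by
      rw [hab, Subring.coe_mul, norm_mul]
    rw [hnp] at hprod
    have hp0 : (0 : ℝ) < (p : ℝ)⁻¹ := inv_pos.mpr (by exact_mod_cast hp'.pos)
    have hlt : (p : ℝ)⁻¹ * (p : ℝ)⁻¹ < (p : ℝ)⁻¹ * 1 :=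
      mul_lt_mul_of_pos_left (inv_lt_one_of_one_lt₀ hpR) hp0
    have hle : ‖(a : ℂ_[p])‖ * ‖(b : ℂ_[p])‖ ≤ (p : ℝ)⁻¹ * (p : ℝ)⁻¹ :=
      mul_le_mul ha hb (norm_nonneg _) hp0.le
    rw [← hprod] at hle
    rw [mul_one] at hlt
    exact (lt_irrefl _) (hle.trans_lt hlt)

/-- **Every nonzero `x ∈ R₀` is `p^n` times a unit** (`R₀` is discretely valued with value group
`p^ℤ`: tree `R1.exists_norm_eq_inv_pow`). [cite: Castella2018, §3 (p. 9)] -/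
theorem exists_associated_pow_natCast_p {x : unrIntegers p} (hx : x ≠ 0) :
    ∃ n : ℕ, Associated (((p : ℕ) : unrIntegers p) ^ n) x := by
  have hx0 : (x : ℂ_[p]) ≠ 0 := fun h ↦ hx (Subtype.ext h)
  obtain ⟨n, hn, hmem⟩ := R1.exists_norm_eq_inv_pow x.2 hx0
  have hp0 : (p : ℂ_[p]) ≠ 0 := by exact_mod_cast hp.out.ne_zero
  set u : unrIntegers p := ⟨(x : ℂ_[p]) / (p : ℂ_[p]) ^ n, hmem⟩ with hu
  have hun : ‖(u : ℂ_[p])‖ = 1 := by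
    have hpn : ‖(p : ℂ_[p]) ^ n‖ = ((p : ℝ)⁻¹) ^ n := by rw [norm_pow, norm_natCast_p_padicComplex]
    rw [hu, Subtype.coe_mk, norm_div, hn, hpn, div_self]
    exact pow_ne_zero _ (inv_ne_zero (by exact_mod_cast hp.out.ne_zero))
  obtain ⟨v, hv⟩ := isUnit_of_norm_eq_one hun
  refine ⟨n, v, Subtype.ext ?_⟩
  have hv' : ((v : unrIntegers p) : ℂ_[p]) = (x : ℂ_[p]) / (p : ℂ_[p]) ^ n := by rw [hv]
  push_cast
  rw [hv', mul_comm]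
  exact div_mul_cancel₀ _ (pow_ne_zero _ hp0)

/-- **`R₀ = 𝒪(\widehat{ℚ_p^{ur}})` is a discrete valuation ring** (uniformiser `p`). A THEOREM,
not an instance (statement files declare none); use `haveI` locally.
[cite: Castella2018, §3 (p. 9)] [cite: SerreLocalFields1979, Ch. II §5, Thm. 3] -/
theorem isDiscreteValuationRing_unrIntegers : IsDiscreteValuationRing (unrIntegers p) :=
  IsDiscreteValuationRing.ofHasUnitMulPowIrreducibleFactorization
    ⟨((p : ℕ) : unrIntegers p), irreducible_natCast_p, fun hx ↦ exists_associated_pow_natCast_p hx⟩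

/-- `R₀` is Noetherian (a DVR is a PID). [folklore] -/
theorem isNoetherianRing_unrIntegers : IsNoetherianRing (unrIntegers p) := by
  haveI := isDiscreteValuationRing_unrIntegers (p := p)
  infer_instance

/-- **`Λ^nr = R₀⟦T⟧` is Noetherian** (power series over a Noetherian ring). [folklore] -/
theorem isNoetherianRing_unrSeries : IsNoetherianRing (UnrSeries p) := by
  haveI := isNoetherianRing_unrIntegers (p := p)
  exact inferInstance

/-- `Λ^nr = R₀⟦T⟧` is a local ring (power series over the local ring `R₀`). [folklore] -/
theorem isLocalRing_unrSeries : IsLocalRing (UnrSeries p) := by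
  haveI := isDiscreteValuationRing_unrIntegers (p := p)
  exact inferInstance

/-- **`(p) ⊆ Jac(R₀⟦T⟧)`**: `R₀⟦T⟧` is local and `p` is not a unit there (its constant term `p` is
not a unit of `R₀`). [folklore] -/
theorem span_C_p_le_jacobson_unrSeries :
    Ideal.span {(C ((p : ℕ) : unrIntegers p) : UnrSeries p)} ≤ (⊥ : Ideal (UnrSeries p)).jacobson := by
  haveI := isLocalRing_unrSeries (p := p)
  rw [IsLocalRing.jacobson_eq_maximalIdeal ⊥ bot_ne_top, Ideal.span_le, Set.singleton_subset_iff]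
  intro hu
  have h2 := PowerSeries.isUnit_iff_constantCoeff.mp hu
  rw [PowerSeries.constantCoeff_C] at h2
  exact (irreducible_natCast_p (p := p)).not_isUnit h2

end UnrIntegers

/-! ## §2 The one-sided REVERSE congruence limit across a ring map (no tensor products) -/

section OneSidedReverse

variable {R : Type u} [CommRing R] {S : Type v} [CommRing S] [IsNoetherianRing S] (φ : R →+* S)
  (I : Ideal R) {M : Type*} [AddCommGroup M] [Module R M] [Module.Finite R M]
  (N : ℕ → Type*) [∀ m, AddCommGroup (N m)] [∀ m, Module R (N m)] [∀ m, Module.Finite R (N m)]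

omit [IsNoetherianRing S] in
/-- **One step**: `φ(Fitt₀(M)) ⊆ (L) + φ(I)^m` from `e_m : M/I^m ≅ N_m/I^m` over `R`, the member-side
inclusion `φ(Fitt₀(N_m)) ⊆ (L_m)` and the congruence `(L_m) + φ(I)^m = (L) + φ(I)^m` in `S`
(«basic properties of Fitting ideals», taken over `R` and pushed along `φ`).
[cite: Skinner2016PacificMC, §3.1 (p. 192)] [cite: Castella2018Erratum, proof of Thm. 1.1 (p. 4)] -/
theorem map_fittingIdeal_le_sup_of_congruence {L Lm : S} {m : ℕ}
    (e : (M ⧸ (I ^ m • (⊤ : Submodule R M))) ≃ₗ[R] (N m ⧸ (I ^ m • (⊤ : Submodule R (N m)))))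
    (hF : (Module.fittingIdeal R (N m) 0).map φ ≤ Ideal.span {Lm})
    (hc : Ideal.span {Lm} ⊔ (I.map φ) ^ m = Ideal.span {L} ⊔ (I.map φ) ^ m) :
    (Module.fittingIdeal R M 0).map φ ≤ Ideal.span {L} ⊔ (I.map φ) ^ m := by
  have h1 : (Module.fittingIdeal R M 0).map φ ≤ (Module.fittingIdeal R M 0 ⊔ I ^ m).map φ :=
    Ideal.map_mono le_sup_left
  rw [fittingIdeal_sup_eq_of_quotEquiv (I ^ m) e 0, Ideal.map_sup, Ideal.map_pow] at h1
  rw [← hc]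
  exact h1.trans (sup_le_sup_right hF _)

/-- **The one-sided REVERSE congruence limit across `φ : R → S`** (`S` Noetherian,
`φ(I) ⊆ Jac(S)`). Hypotheses: `J ⊆ Fitt₀_R(M)` (`J = (p)^a·(g)`: the finite submodule of the FIXED
module), for every `m ≥ 1` an `R`-isomorphism `M/I^m ≅ N_m/I^m` [(α) + control], the ONE-SIDED
member inclusion `φ(Fitt₀_R(N_m)) ⊆ (L_m)` [(d)] and `(L_m) + φ(I)^m = (L) + φ(I)^m` [(b)]. Then
`φ(J) ⊆ ⋂_m ((L) + φ(I)^m) = (L)` (Krull, tree `iInf_sup_pow_eq_self`). This is the two-ring,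
reverse-direction half of `X2.KellerYinFreePartGap.charIdeal_eq_span_of_oneSided_congruences`
(which continues with `μ = 0` + `λ` to the equality); NO torsionness or finite-submodule
hypothesis on the `N_m`. [cite: Skinner2016PacificMC, §3.1 (p. 192)]
[cite: Castella2018Erratum, proof of Thm. 1.1 (p. 4)] [cite: StacksProject, Tag 05GI (Krull)] -/
theorem map_le_span_of_oneSided_congruences (hI : I.map φ ≤ (⊥ : Ideal S).jacobson)
    {J : Ideal R} (hJ : J ≤ Module.fittingIdeal R M 0) (L : S) (Lm : ℕ → S)
    (e : ∀ m : ℕ, 1 ≤ m →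
      ((M ⧸ (I ^ m • (⊤ : Submodule R M))) ≃ₗ[R] (N m ⧸ (I ^ m • (⊤ : Submodule R (N m))))))
    (hF : ∀ m : ℕ, 1 ≤ m → (Module.fittingIdeal R (N m) 0).map φ ≤ Ideal.span {Lm m})
    (hc : ∀ m : ℕ, 1 ≤ m →
      Ideal.span {Lm m} ⊔ (I.map φ) ^ m = Ideal.span {L} ⊔ (I.map φ) ^ m) :
    J.map φ ≤ Ideal.span {L} := by
  refine (Ideal.map_mono hJ).trans ?_
  rw [← iInf_sup_pow_eq_self (I.map φ) (Ideal.span {L}) hI]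
  refine le_iInf fun m ↦ ?_
  rcases Nat.eq_zero_or_pos m with rfl | hm
  · rw [pow_zero, Ideal.one_eq_top, sup_top_eq]; exact le_top
  · exact map_fittingIdeal_le_sup_of_congruence φ I N (e m hm) (hF m hm) (hc m hm)

/-- **The member-side input from the PRINTED shape of a main conjecture.** If `N` is `R`-torsion
with `φ(Ch_R(N)) ⊆ (L')` in `S` (the member's IMC gives `Ch(𝔛_{f_m})·Λ^nr = (𝓛_{f_m})`, of which
only `⊆` is used), then `φ(Fitt₀_R(N)) ⊆ (L')` (`Fitt₀ ⊆ Ch` for torsion modules over a Noetherian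
UFD, tree `fittingIdeal_zero_le_charIdeal`). [cite: StacksProject, Tag 07ZA] -/
theorem map_fittingIdeal_le_of_map_charIdeal_le {R' : Type*} [CommRing R'] [IsNoetherianRing R']
    [IsDomain R'] [UniqueFactorizationMonoid R'] {S' : Type*} [CommRing S'] (ψ : R' →+* S')
    {N' : Type*} [AddCommGroup N'] [Module R' N'] [Module.Finite R' N'] (hT : Module.IsTorsion R' N')
    {L' : S'} (hCh : (charIdeal R' N').map ψ ≤ Ideal.span {L'}) :
    (Module.fittingIdeal R' N' 0).map ψ ≤ Ideal.span {L'} :=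
  (Ideal.map_mono (fittingIdeal_zero_le_charIdeal hT)).trans hCh

end OneSidedReverse

/-! ## §3 At `Λ = ℤ_p⟦T⟧ → Λ^nr = R₀⟦T⟧`: the body of `HidaLimitRevDivOnTree` from member data -/

section Iwasawa

variable {p : ℕ} [hp : Fact p.Prime]

/-- `map toUnr` sends `(p) ⊆ Λ` to `(p) ⊆ R₀⟦T⟧`. [folklore] -/
theorem map_span_C_p :
    (Ideal.span {(C (p : ℤ_[p]) : IwasawaAlgebra p)}).map (PowerSeries.map (toUnr p)) =
      Ideal.span {(C ((p : ℕ) : unrIntegers p) : UnrSeries p)} := by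
  rw [Ideal.map_span, Set.image_singleton, PowerSeries.map_C, map_natCast]

/-- **Road H's output from road H's inputs, in the kernel.** Over `Λ = ℤ_p⟦T⟧` let `M` be a finite
module (`X_ac^∅(E[p^∞])`) and `F ∈ Λ` with `(p)^a·(F) ⊆ Fitt₀_Λ(M)` (`F` a generator of `Ch_Λ(M)`,
`a` the exponent of the finite submodule); for every `m ≥ 1` let `N_m` be a finite `Λ`-module
(`𝔛_{f_m}`) with a `Λ`-isomorphism `M/p^m ≅ N_m/p^m` [(α) lattice congruence + control — cgshw
MEMO-9], `L_m ∈ R₀⟦T⟧` with `Fitt₀_Λ(N_m)·R₀⟦T⟧ ⊆ (L_m)` [(d) the member's IMC, KY Thm. 3.0.8, all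
weights — cgshw MEMO-8] and `(L_m) + (p)^m = (L) + (p)^m` in `R₀⟦T⟧` [(b) the two-variable
`L`-function, Castella 2020 §1.5]. THEN `C(p^a)·F^nr ∈ (L)` in `R₀⟦T⟧` — verbatim the conclusion
of `X2.HidaLimitRevDivOnTree` (p419866) at the datum. Pure algebra; the inputs are NOT constructed
here; nothing is asserted about any curve. [cite: KellerYin2024, §5.1 (a)–(e) and Lemma 5.1.2 (arXiv:2402.12781v2) (shape only)]
[cite: Skinner2016PacificMC, §3.1 (p. 192)] [cite: Castella2018Erratum, proof of Thm. 1.1 (p. 4)] -/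
theorem C_pow_mul_map_mem_span_of_oneSided_congruences
    {M : Type*} [AddCommGroup M] [Module (IwasawaAlgebra p) M] [Module.Finite (IwasawaAlgebra p) M]
    (N : ℕ → Type*) [∀ m, AddCommGroup (N m)] [∀ m, Module (IwasawaAlgebra p) (N m)]
    [∀ m, Module.Finite (IwasawaAlgebra p) (N m)]
    {F : IwasawaAlgebra p} {a : ℕ}
    (hfitt : Ideal.span {(C (p : ℤ_[p]) : IwasawaAlgebra p)} ^ a * Ideal.span {F} ≤
      Module.fittingIdeal (IwasawaAlgebra p) M 0)
    (L : UnrSeries p) (Lm : ℕ → UnrSeries p)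
    (e : ∀ m : ℕ, 1 ≤ m →
      ((M ⧸ ((Ideal.span {(C (p : ℤ_[p]) : IwasawaAlgebra p)}) ^ m •
          (⊤ : Submodule (IwasawaAlgebra p) M))) ≃ₗ[IwasawaAlgebra p]
        (N m ⧸ ((Ideal.span {(C (p : ℤ_[p]) : IwasawaAlgebra p)}) ^ m •
          (⊤ : Submodule (IwasawaAlgebra p) (N m))))))
    (hF : ∀ m : ℕ, 1 ≤ m →
      (Module.fittingIdeal (IwasawaAlgebra p) (N m) 0).map (PowerSeries.map (toUnr p)) ≤
        Ideal.span {Lm m})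
    (hc : ∀ m : ℕ, 1 ≤ m →
      Ideal.span {Lm m} ⊔ (Ideal.span {(C ((p : ℕ) : unrIntegers p) : UnrSeries p)}) ^ m =
        Ideal.span {L} ⊔ (Ideal.span {(C ((p : ℕ) : unrIntegers p) : UnrSeries p)}) ^ m) :
    C (((p : ℕ) : unrIntegers p) ^ a) * PowerSeries.map (toUnr p) F ∈
      Ideal.span ({L} : Set (UnrSeries p)) := by
  haveI := isNoetherianRing_unrSeries (p := p)
  have hI : (Ideal.span {(C (p : ℤ_[p]) : IwasawaAlgebra p)}).map (PowerSeries.map (toUnr p)) ≤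
      (⊥ : Ideal (UnrSeries p)).jacobson := by
    rw [map_span_C_p]; exact span_C_p_le_jacobson_unrSeries
  have hc' : ∀ m : ℕ, 1 ≤ m → Ideal.span {Lm m} ⊔
      ((Ideal.span {(C (p : ℤ_[p]) : IwasawaAlgebra p)}).map (PowerSeries.map (toUnr p))) ^ m =
        Ideal.span {L} ⊔
      ((Ideal.span {(C (p : ℤ_[p]) : IwasawaAlgebra p)}).map (PowerSeries.map (toUnr p))) ^ m := by
    intro m hm; rw [map_span_C_p]; exact hc m hm
  have key := map_le_span_of_oneSided_congruences (PowerSeries.map (toUnr p))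
    (Ideal.span {(C (p : ℤ_[p]) : IwasawaAlgebra p)}) N hI hfitt L Lm e hF hc'
  refine key ?_
  rw [Ideal.map_mul, Ideal.map_pow, map_span_C_p, Ideal.map_span, Set.image_singleton,
    Ideal.span_singleton_pow, ← map_pow]
  exact Ideal.mul_mem_mul (Ideal.mem_span_singleton_self _) (Ideal.mem_span_singleton_self _)

end Iwasawa

end Summit.BirchSwinnertonDyer.Rank1Residual.X2.HidaLimitAlgebra

end
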